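import Literature.AlgebraicGeometry.Motives.FrobeniusMorphism
import Mathlib.AlgebraicGeometry.Morphisms.Finite
import Mathlib.AlgebraicGeometry.Morphisms.Integral
import Mathlib.AlgebraicGeometry.Morphisms.FiniteType
import Mathlib.FieldTheory.Perfect
import Mathlib.Algebra.CharP.Lemmas
import HarnessLib

/-!
# `PAlteration.Assembly` (stmt-ResolutionOfSingularities-0553): finiteness of Frobenius powers

Route `ResolutionOfSingularities/pAlteration`, item `Assembly` (stmt-0553); helper file
(`--supports`). For a scheme `X` locally of finite type over a PERFECT field `K` of characteristic
`p`, the power endomorphism `F = powEndo X (p ^ N)` (identity on points, `s ↦ s^{p^N}` on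
functions; `Literature.AlgebraicGeometry.Motives.powEndo`) is a FINITE morphism:

* it is affine (preimages of opens are unchanged) and integral on every ring of sections
  (`s` is a root of `T^{p^N} - F(s)`), for any scheme — `isIntegralHom_powEndo`;
* it is locally of finite type because `F_X ≫ f = f ≫ F_{Spec K}` and `F_{Spec K}` is an
  isomorphism for `K` perfect — `locallyOfFiniteType_powEndo`;
* finite = integral + locally of finite type — `isFinite_powEndo`.

Also: the characteristic of the sections of a `K`-scheme (`natCast_sections_eq_zero_of_hom`) and
additivity of `s ↦ s^{p^N}` there (`add_pow_sections`), the inputs `powEndo` needs.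
-/

-- single-problem summit: the doubled namespace component `ResolutionOfSingularities` is forced
set_option linter.dupNamespace false

noncomputable section

open CategoryTheory CategoryTheory.Limits AlgebraicGeometry TopologicalSpace Polynomial

open Literature.AlgebraicGeometry.Motives

namespace Summit.ResolutionOfSingularities.ResolutionOfSingularities.Theorems

universe u

/-! ## Characteristic `p` on sections -/

section CharP

variable (p : ℕ) [Fact p.Prime]

omit [Fact p.Prime] in
/-- For a scheme over a field of characteristic `p`, `p = 0` in the ring of global sections.
[folklore] -/
theorem natCast_appTop_eq_zero {X : Scheme.{u}} {K : Type u} [Field K] [CharP K p]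
    (f : X ⟶ Spec (.of K)) : (p : Γ(X, ⊤)) = 0 := by
  have h : (p : Γ(Spec (CommRingCat.of K), ⊤)) = 0 := by
    rw [← map_natCast (Scheme.ΓSpecIso (.of K)).inv.hom p]
    simp only [CommRingCat.coe_of, CharP.cast_eq_zero, map_zero]
  rw [← map_natCast f.appTop.hom p, h, map_zero]

/-- On a scheme with `p = 0` in its global sections, `s ↦ s^{p^N}` is additive on every ring of
sections. [folklore] -/
theorem add_pow_sections {X : Scheme.{u}} (hp : (p : Γ(X, ⊤)) = 0) (N : ℕ) :
    ∀ (U : X.Opens) (a b : Γ(X, U)), (a + b) ^ p ^ N = a ^ p ^ N + b ^ p ^ N :=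
  fun U a b => add_pow_prime_pow_of_natCast_eq_zero p (natCast_sections_eq_zero X p hp U) N a b

end CharP

/-! ## Power endomorphisms are integral -/

section Integral

/-- The power map `r ↦ rⁿ` (when additive) is an integral ring homomorphism: `r` is a root of the
monic polynomial `Tⁿ - rⁿ`. [folklore] -/
theorem isIntegral_powRingHom (R : Type u) [CommRing R] (n : ℕ) (hn : n ≠ 0)
    (hadd : ∀ a b : R, (a + b) ^ n = a ^ n + b ^ n) :
    (powRingHom R n hn hadd).IsIntegral := by
  intro r
  refine ⟨X ^ n - C r, Polynomial.monic_X_pow_sub_C r hn, ?_⟩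
  simp [eval₂_sub, eval₂_X_pow, eval₂_C, powRingHom_apply]

variable (X : Scheme.{u}) (n : ℕ) (hn : n ≠ 0)
  (hadd : ∀ (U : X.Opens) (a b : Γ(X, U)), (a + b) ^ n = a ^ n + b ^ n)

/-- The power endomorphism restricted over an open `U` is the power endomorphism of `U`.
[folklore] -/
theorem powEndo_morphismRestrict (U : X.Opens)
    (haddU : ∀ (V : (U : Scheme.{u}).Opens) (a b : Γ(U, V)), (a + b) ^ n = a ^ n + b ^ n) :
    powEndo X n hn hadd ∣_ U = powEndo (U : Scheme.{u}) n hn haddU := by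
  rw [← cancel_mono U.ι, morphismRestrict_ι]
  exact (powEndo_comp n hn haddU U.ι hadd).symm

-- as in Mathlib's `morphismRestrict_app`: sections of an open subscheme vs. sections of `X`
set_option backward.isDefEq.respectTransparency false in
/-- The power endomorphism of any scheme is an integral morphism: it is affine (it does not move
opens) and `s ↦ sⁿ` is an integral ring map. [folklore] -/
theorem isIntegralHom_powEndo : IsIntegralHom (powEndo X n hn hadd) := by
  rw [HasAffineProperty.iff_of_iSup_eq_top (P := @IsIntegralHom) (fun U : X.affineOpens => U)
    (iSup_affineOpens_eq_top X)]
  intro U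
  refine ⟨U.2, ?_⟩
  rw [morphismRestrict_app, powEndo_app, CommRingCat.hom_comp, CommRingCat.hom_ofHom]
  refine RingHom.IsIntegral.trans _ _ (isIntegral_powRingHom _ n hn _) ?_
  exact RingHom.isIntegral_of_surjective _
    (ConcreteCategory.bijective_of_isIso (X.presheaf.map _)).2

end Integral

/-! ## Over a perfect field the power endomorphism is finite -/

section Perfect

variable (p : ℕ) [Fact p.Prime] {K : Type u} [Field K] [CharP K p] [PerfectField K]

/-- Over a perfect field `K` of characteristic `p`, the `p^N`-th power endomorphism of `Spec K` is
an isomorphism (it is `Spec` of the iterated Frobenius automorphism). [folklore] -/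
theorem isIso_powEndo_Spec_perfectField (N : ℕ)
    (hadd : ∀ (U : (Spec (CommRingCat.of K)).Opens) (a b : Γ(Spec (CommRingCat.of K), U)),
      (a + b) ^ p ^ N = a ^ p ^ N + b ^ p ^ N) :
    IsIso (powEndo (Spec (.of K)) (p ^ N) (pow_ne_zero N (Fact.out : p.Prime).ne_zero) hadd) := by
  haveI : PerfectRing K p := PerfectField.toPerfectRing p
  have haddK : ∀ a b : K, (a + b) ^ p ^ N = a ^ p ^ N + b ^ p ^ N := fun a b => add_pow_char_pow a b p N
  rw [powEndo_Spec (p ^ N) _ K haddK hadd]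
  have he : powRingHom K (p ^ N) (pow_ne_zero N (Fact.out : p.Prime).ne_zero) haddK =
      (iterateFrobeniusEquiv K p N).toRingHom := by
    ext x
    simp [powRingHom_apply, iterateFrobenius_def]
  rw [he]
  change IsIso (Spec.map ((iterateFrobeniusEquiv K p N).toCommRingCatIso).hom)
  infer_instance

variable {X : Scheme.{u}} (f : X ⟶ Spec (.of K))

/-- Over a perfect field of characteristic `p`, the `p^N`-th power endomorphism of a scheme
locally of finite type is locally of finite type (`F_X ≫ f = f ≫ F_{Spec K}` with `F_{Spec K}` an
isomorphism). [folklore] -/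
theorem locallyOfFiniteType_powEndo [LocallyOfFiniteType f] (N : ℕ)
    (hadd : ∀ (U : X.Opens) (a b : Γ(X, U)), (a + b) ^ p ^ N = a ^ p ^ N + b ^ p ^ N) :
    LocallyOfFiniteType (powEndo X (p ^ N) (pow_ne_zero N (Fact.out : p.Prime).ne_zero) hadd) := by
  have hK : ((p : ℕ) : Γ(Spec (CommRingCat.of K), ⊤)) = 0 :=
    natCast_appTop_eq_zero p (𝟙 (Spec (.of K)))
  have haddK := add_pow_sections p hK N
  haveI := isIso_powEndo_Spec_perfectField p N haddK
  haveI : LocallyOfFiniteType (powEndo X (p ^ N) (pow_ne_zero N (Fact.out : p.Prime).ne_zero)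
      hadd ≫ f) := by
    rw [powEndo_comp (p ^ N) _ hadd f haddK]
    infer_instance
  exact locallyOfFiniteType_of_comp _ f

/-- **Finiteness of Frobenius powers over a perfect field**: for `X` locally of finite type over
a perfect field `K` of characteristic `p`, the `p^N`-th power endomorphism of `X` (the `N`-th
power of the absolute Frobenius) is a finite morphism. [folklore] -/
theorem isFinite_powEndo [LocallyOfFiniteType f] (N : ℕ)
    (hadd : ∀ (U : X.Opens) (a b : Γ(X, U)), (a + b) ^ p ^ N = a ^ p ^ N + b ^ p ^ N) :
    IsFinite (powEndo X (p ^ N) (pow_ne_zero N (Fact.out : p.Prime).ne_zero) hadd) := by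
  rw [IsFinite.iff_isIntegralHom_and_locallyOfFiniteType]
  exact ⟨isIntegralHom_powEndo X (p ^ N) _ hadd, locallyOfFiniteType_powEndo p f N hadd⟩

end Perfect


end Summit.ResolutionOfSingularities.ResolutionOfSingularities.Theorems

end
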